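import Summits.HodgeConjecture.CorCM.GaloisIndexTwoRealFactor
import HarnessLib

/-!
# Two independent `c`-avoiding cyclic subgroups of `A` ⟹ BAD (any `q`): «composite ⟹ degenerate» on the hard side

COR-CM (cell `pub-hodgecm2`), binder seat b04 (gen 30), count-neutral own lane «Galois-CM-type classification» (which Galois CM
fields `(G, c)` have ALL primitive CM types nondegenerate = GOOD, vs. a primitive degenerate type = BAD).  KERNEL ONLY: theorems;
no definition, no named fact, no `sorry`.  `HC_CM` is neither used nor claimed.

SETTING.  `G₀ = i(A) ⊔ i(A)x`, `A` abelian of index two, `θ = conj_x`, `x² = i(q)` ARBITRARY, complex conjugation `c ∈ A`.  The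
two-periodic-sheets criterion (`CorCM/GaloisTwoPeriodicSheets`) in its natural generality: sheets `S_j = π_j⁻¹(H̄_j)` pulled back
from APERIODIC halves of `A/⟨u_j⟩` (`j = 0, 1`), which exist as soon as `|A/⟨u_j⟩| > 4` (`exists_aperiodic_half`).

THEOREM (**`exists_simple_degenerate_of_two_cyclic`**).  `u₀, u₁ ∈ A` with: `c ∉ ⟨u₀⟩`, `c ∉ ⟨u₁⟩`, `u₀ ≠ 1`, `u₁ ∉ ⟨u₀, c⟩`
(independence — gives an odd character non-trivial on both: an odd `χ₁` with `χ₁(u₀) ≠ 1`, times, if needed, an even character of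
`A/⟨u₀, c⟩` seeing `u₁`), `⟨u₀⟩ ∩ ⟨u₁⟩ = 1` (no common period), `θ(u₀) ∉ ⟨u₁⟩` (so `a·θ(S₀) ≠ S₁`), and `4·ord(u_j) < |A|` ⟹ `K` carries
a SIMPLE DEGENERATE abelian variety of dimension `|G₀|/2` with CM by `K` (rational `(p,p)` class outside the divisor ring on some
power).

SCOPE.  This contains the index-two real-factor theorem (`CorCM/GaloisIndexTwoRealFactor`: `u₀ ∈ C` central, `u₁ ∈ A₀`) and adds
the NON-product hard-side groups with two independent cyclic pieces: generalised dicyclic `Dic(A₀) = ⟨A₀, x | x² = c, xax⁻¹ = a⁻¹⟩`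
with `A₀ ⊋` cyclic-2-group·`⟨c⟩` pieces (e.g. `Dic(C₄ × C₄)`, order 32 — census BAD), `Dic_{pq}` and `Dic_n` with composite odd part
(gen 20), the metacyclic `C_m ⋊ C_{2^k}` with `m` divisible by two coprime numbers or `m = ℓ²`… (`u₀ ∈ C_ℓ`, `u₁ ∈ C_{ℓ'}`), versus the
ARITHMETIC cases where `A` has at most one `c`-avoiding cyclic direction (`Q₈ × C_p`, `C_p ⋊ C₈`, `Dic_p`: silent, as it must be).

## References

* [Kubota1965] T. Kubota, *On the field extension by complex multiplication*, Trans. AMS 118 (1965), §2, §4 Lemma 2.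
* [Shimura1998] G. Shimura, *Abelian Varieties with Complex Multiplication and Modular Functions*, §6.2 Thm. 3, §8.2 Prop. 26.
* [Gordon1999HodgeAVSurvey] B. B. Gordon, *A survey of the Hodge conjecture for abelian varieties*, Thm. 6.4, §9.3.
-/

noncomputable section

open CategoryTheory CategoryTheory.Limits NumberField
open scoped BigOperators

namespace Summit.HodgeConjecture.CorCM.SplitInvolution

open Literature.NumberTheory.ComplexMultiplication
open Literature.AlgebraicGeometry.Motives (AbelianVariety CMType)
open Literature.AlgebraicGeometry.HodgeTheory
open Literature.AlgebraicGeometry.ComplexMultiplication (IsCMTypeRealisation)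
open Literature.AlgebraicGeometry.Pohlmann1968
open Literature.Barriers.HodgeConjecture (divisorClassesSpan)
open Summit.HodgeConjecture.CorCM.GaloisRank (model_complexConj_mul_self model_complexConj_comm)

section Pullback

variable {A : Type*} [CommGroup A] [Fintype A] [DecidableEq A]

omit [DecidableEq A] in
/-- **Pull-back of an aperiodic half along `A → A/⟨u⟩`**: `c ∉ ⟨u⟩`, `c² = 1`, `4·ord u < |A|` ⟹ a CM half `S` of `(A, c)` which is
`u`-periodic and whose periods all lie in `⟨u⟩` (pointwise: `v ∉ ⟨u⟩` is not a period), together with the aperiodicity witness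
transport used for reflections: for every `v ∉ ⟨u⟩` and every bijection-free use we only need the two facts returned.
[folklore] -/
theorem exists_pullback_half (c u : A) (hcc : c * c = 1) (hcu : c ∉ Subgroup.zpowers u)
    (hQ : 4 * orderOf u < Fintype.card A) :
    ∃ S : Finset A, (∀ a, a ∈ S ↔ c * a ∉ S) ∧ (∀ a, a ∈ S ↔ u * a ∈ S) ∧
      ∀ v : A, v ∉ Subgroup.zpowers u → ∃ a, ¬ (a ∈ S ↔ v * a ∈ S) := by
  classical
  let π : A →* A ⧸ Subgroup.zpowers u := QuotientGroup.mk' (Subgroup.zpowers u)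
  haveI : Fintype (A ⧸ Subgroup.zpowers u) := Fintype.ofFinite _
  have hπc1 : π c ≠ 1 := fun h => hcu ((QuotientGroup.eq_one_iff c).1 h)
  have hπcc : π c * π c = 1 := by rw [← map_mul, hcc, map_one]
  have hπu : π u = 1 := (QuotientGroup.eq_one_iff u).2 (Subgroup.mem_zpowers u)
  have hcardQ : 4 < Fintype.card (A ⧸ Subgroup.zpowers u) := by
    have hL := Subgroup.card_eq_card_quotient_mul_card_subgroup (Subgroup.zpowers u)
    rw [Nat.card_eq_fintype_card, Nat.card_eq_fintype_card, Nat.card_eq_fintype_card, Fintype.card_zpowers] at hL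
    have hpos : 0 < orderOf u := orderOf_pos u
    by_contra hle
    push Not at hle
    have : Fintype.card A ≤ 4 * orderOf u := by rw [hL]; exact Nat.mul_le_mul_right _ hle
    omega
  obtain ⟨H, hH, hHap⟩ := exists_aperiodic_half (π c) hπc1 hπcc hcardQ
  refine ⟨Finset.univ.filter fun a => π a ∈ H, fun a => ?_, fun a => ?_, fun v hv => ?_⟩
  · simp only [Finset.mem_filter, Finset.mem_univ, true_and, map_mul]; exact hH (π a)
  · simp only [Finset.mem_filter, Finset.mem_univ, true_and, map_mul, hπu, one_mul]
  · have hπv : π v ≠ 1 := fun h => hv ((QuotientGroup.eq_one_iff v).1 h)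
    obtain ⟨m, hm⟩ := hHap (π v) hπv
    obtain ⟨a, ha⟩ := QuotientGroup.mk'_surjective (Subgroup.zpowers u) m
    refine ⟨a, ?_⟩
    simp only [Finset.mem_filter, Finset.mem_univ, true_and, map_mul]
    change π a = m at ha
    rw [ha]; exact hm

omit [DecidableEq A] in
/-- **An odd character non-trivial on two independent elements**: `c ≠ 1`, `c² = 1`, `u₀ ≠ 1`, `u₁ ∉ ⟨u₀, c⟩` ⟹ some `χ` with
`χ(c) = −1`, `χ(u₀) ≠ 1`, `χ(u₁) ≠ 1`. [folklore] -/
theorem exists_odd_character_ne_one_ne_one {c u₀ u₁ : A} (hc1 : c ≠ 1) (hcc : c * c = 1) (hu₀ : u₀ ≠ 1)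
    (hind : u₁ ∉ Subgroup.closure ({u₀, c} : Set A)) :
    ∃ χ : AddChar (Additive A) ℂ, χ (Additive.ofMul c) = -1 ∧ χ (Additive.ofMul u₀) ≠ 1 ∧ χ (Additive.ofMul u₁) ≠ 1 := by
  classical
  obtain ⟨χ₁, hχ₁c, hχ₁u⟩ := exists_odd_character_ne_one hc1 hcc hu₀
  by_cases h1 : χ₁ (Additive.ofMul u₁) = 1
  · -- an even character trivial on `u₀` seeing `u₁`, from the quotient by `⟨u₀, c⟩`
    let N : Subgroup A := Subgroup.closure ({u₀, c} : Set A)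
    let ρ : A →* A ⧸ N := QuotientGroup.mk' N
    haveI : Fintype (A ⧸ N) := Fintype.ofFinite _
    have hρ1 : ρ u₁ ≠ 1 := fun h => hind ((QuotientGroup.eq_one_iff u₁).1 h)
    obtain ⟨ψ₀, hψ₀⟩ := exists_character_ne_one hρ1
    let ψ : AddChar (Additive A) ℂ := ψ₀.compAddMonoidHom (MonoidHom.toAdditive ρ)
    have hψ_apply : ∀ a : A, ψ (Additive.ofMul a) = ψ₀ (Additive.ofMul (ρ a)) := fun a => rfl
    have hρu₀ : ρ u₀ = 1 := (QuotientGroup.eq_one_iff u₀).2 (Subgroup.subset_closure (by simp))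
    have hρc : ρ c = 1 := (QuotientGroup.eq_one_iff c).2 (Subgroup.subset_closure (by simp))
    refine ⟨χ₁ * ψ, ?_, ?_, ?_⟩
    · rw [AddChar.mul_apply, hχ₁c, hψ_apply, hρc, ofMul_one, AddChar.map_zero_eq_one, mul_one]
    · rw [AddChar.mul_apply, hψ_apply, hρu₀, ofMul_one, AddChar.map_zero_eq_one, mul_one]; exact hχ₁u
    · rw [AddChar.mul_apply, h1, one_mul, hψ_apply]; exact hψ₀
  · exact ⟨χ₁, hχ₁c, hχ₁u, h1⟩

end Pullback

section Field

variable {G₀ : Type*} [Group G₀] [Fintype G₀] [DecidableEq G₀]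
variable {A : Type*} [CommGroup A] [Fintype A] [DecidableEq A]
variable {K : Type} [Field K] [NumberField K] [IsCMField K] [IsGalois ℚ K]

/-- **TWO INDEPENDENT `c`-AVOIDING CYCLIC SUBGROUPS ⟹ BAD (any `q`).**  `K` Galois CM, `e : Gal(K/ℚ) ≃* G₀`, `i : A ↪ G₀` abelian
of index two (`G₀ = i(A) ⊔ i(A)x`), `x i(a) = i(θ a) x`, `x² = i(q)`, complex conjugation `e(c̄) = i(c)`.  If `u₀, u₁ ∈ A` satisfy
`c ∉ ⟨u₀⟩`, `c ∉ ⟨u₁⟩`, `u₀ ≠ 1`, `u₁ ∉ ⟨u₀, c⟩`, `⟨u₀⟩ ∩ ⟨u₁⟩ = 1`, `θ(u₀) ∉ ⟨u₁⟩`, `4·ord(u₀) < |A|`, `4·ord(u₁) < |A|`, THEN `K`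
has a PRIMITIVE DEGENERATE CM type, realised by a SIMPLE abelian variety of dimension `|G₀|/2` with CM by `K` carrying a rational
`(p,p)` class outside the divisor ring on some power. [cite: Kubota1965, §2 and §4 Lemma 2]
[cite: Shimura1998, §6.2 Thm. 3 and §8.2 Prop. 26] [cite: Gordon1999HodgeAVSurvey, Thm. 6.4 and §9.3] -/
theorem exists_simple_degenerate_of_two_cyclic (e : (K ≃ₐ[ℚ] K) ≃* G₀) (i : A →* G₀) (hi : Function.Injective i)
    (x : G₀) (hx : ∀ a, i a ≠ x) (hcov : ∀ g : G₀, (∃ a, g = i a) ∨ (∃ a, g = i a * x)) (θ : A ≃* A)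
    (hθ : ∀ a, x * i a = i (θ a) * x) (q : A) (hq : x * x = i q) (c : A)
    (hc : e ((IsCMField.complexConj K).restrictScalars ℚ) = i c) (u₀ u₁ : A) (hcu₀ : c ∉ Subgroup.zpowers u₀)
    (hcu₁ : c ∉ Subgroup.zpowers u₁) (hu₀ : u₀ ≠ 1) (hind : u₁ ∉ Subgroup.closure ({u₀, c} : Set A))
    (hint : ∀ a, a ∈ Subgroup.zpowers u₀ → a ∈ Subgroup.zpowers u₁ → a = 1) (hθU : θ u₀ ∉ Subgroup.zpowers u₁)
    (hQ₀ : 4 * orderOf u₀ < Fintype.card A) (hQ₁ : 4 * orderOf u₁ < Fintype.card A) :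
    ∃ (Φ : CMType K) (φ₀ : K →+* ℂ) (X : AbelianVariety ℂ) (ι : 𝓞 K →+* End X)
      (ϑ : K →+* Module.End ℂ (complexBetti X.X 1)),
      IsPrimitive (ℂ ≃+* ℂ) Φ.1 φ₀ ∧ ¬ IsNondegenerate Φ ∧ IsCMTypeRealisation Φ X ι ϑ ∧ X.IsSimple ∧
      X.dim = Fintype.card G₀ / 2 ∧
      ∃ n p : ℕ, ∃ y : complexBetti (⨁ fun _ : Fin n => X).X (2 * p), IsRationalClass y ∧
        IsOfHodgeType (⨁ fun _ : Fin n => X).dim (⨁ fun _ : Fin n => X).X (2 * p) p p y ∧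
        y ∉ divisorClassesSpan (⨁ fun _ : Fin n => X).X (⨁ fun _ : Fin n => X).dim p := by
  classical
  -- `c² = 1`, `c ≠ 1`, `θ c = c`
  have hcc : c * c = 1 := hi (by rw [map_mul, map_one]; exact model_complexConj_mul_self e hc)
  have hc1 : c ≠ 1 := by rintro rfl; exact hcu₀ (one_mem _)
  have hθc : θ c = c := by
    have h1 : i c * x = i (θ c) * x := by rw [← hθ, model_complexConj_comm e hc x]
    exact (hi (mul_right_cancel h1)).symm
  -- the two pulled-back halves and the character
  obtain ⟨S₀, hS₀, hu₀S, hap₀⟩ := exists_pullback_half c u₀ hcc hcu₀ hQ₀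
  obtain ⟨S₁, hS₁, hu₁S, hap₁⟩ := exists_pullback_half c u₁ hcc hcu₁ hQ₁
  obtain ⟨χ, hχ, hχ₀, hχ₁⟩ := exists_odd_character_ne_one_ne_one hc1 hcc hu₀ hind
  -- no common period
  have hper : ∀ a : A, a ≠ 1 → (∃ s, ¬ (s ∈ S₀ ↔ a * s ∈ S₀)) ∨ (∃ s, ¬ (s ∈ S₁ ↔ a * s ∈ S₁)) := by
    intro a ha
    by_cases h₀ : a ∈ Subgroup.zpowers u₀
    · have h₁ : a ∉ Subgroup.zpowers u₁ := fun h => ha (hint a h₀ h)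
      exact Or.inr (hap₁ a h₁)
    · exact Or.inl (hap₀ a h₀)
  -- `a·θ(S₀) ≠ S₁`: otherwise `S₁` would be `θ(u₀)`-periodic
  have hrefl : ∀ a : A, (∃ s, ¬ (s ∈ S₀ ↔ a * θ s ∈ S₁)) ∨ (∃ s, ¬ (s ∈ S₁ ↔ a * θ s * q ∈ S₀)) := by
    intro a
    left
    by_contra hcon
    push Not at hcon
    obtain ⟨y, hy⟩ := hap₁ (θ u₀) hθU
    apply hy
    set s : A := θ.symm (a⁻¹ * y) with hs_def
    have hys : a * θ s = y := by rw [hs_def, MulEquiv.apply_symm_apply, mul_inv_cancel_left]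
    have e1 := hcon s
    have e2 := hcon (u₀ * s)
    rw [hys] at e1
    rw [← hu₀S, map_mul, mul_left_comm, hys] at e2
    exact e1.symm.trans e2
  exact exists_simple_degenerate_of_periodic_sheets e i hi x hx hcov θ hθ q hq hc S₀ S₁ hS₀ hS₁ u₀ u₁ hu₀S hu₁S χ hχ hχ₀ hχ₁
    hper hrefl

end Field

end Summit.HodgeConjecture.CorCM.SplitInvolution

end
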